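import Literature.Barriers.RiemannHypothesis.MollifierLimitationsProofs
import Mathlib.MeasureTheory.Measure.Lebesgue.Basic
import Mathlib.Combinatorics.Pigeonhole
import HarnessLib

/-!
# Radziwiłł 2012, Lemma 5: the extraction of a well-spaced set of critical zeros

Sibling of `Literature/Barriers/RiemannHypothesis/MollifierLimitationsProofs.lean`, which vendors
**Lemma 5** of M. Radziwiłł, *Limitations to mollifying `ζ(s)`* (arXiv:1207.6583, §4, p. 8) as the
named fact `Literature.Barriers.RiemannHypothesis.Radziwill2012_lemma5`: for absolute `A, c₀ > 0`
and all large `T` there is a finite set `S` of ordinates `γ ∈ [T, 2T]` of zeros of `ζ` on the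
critical line, pairwise `|γ − γ'| ≥ 2πA/log T`, with `Card S ≥ c₀ T log T`.

The printed proof (p. 8) has two parts.

1. **Selberg's theorem in measure form** ("Selberg's proof ([Titchmarsh], 10.22, p. 279) shows
   that there is an `h = 2πA/log T`, with `A > 0` constant, for which the set
   `E = {T ≤ t ≤ 2T : γ ∈ (t; t + h) for some ρ = ½ + iγ}` has `meas{E} ≥ c·T` with `c > 0`
   constant"). This is A. Selberg's positive-proportion theorem (1942) in the form in which
   Titchmarsh's exposition actually proves it (`m(E) > A₃T`, [Titchmarsh1986, §10.22, p. 279]).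
   In this file it enters as the explicit hypothesis `hE` of `Radziwill2012_lemma5_of_measure`,
   literally in the displayed form. That displayed form is the named fact
   `Literature.Barriers.RiemannHypothesis.Radziwill2012_selbergLemma` of the sibling file
   `MollifierLimitationsSelberg.lean`, which proves the same deduction independently
   (`Radziwill2012_lemma5_of_selbergLemma`, via the truncation `E ∩ [T, 2T − h]` instead of the
   `M = ⌊T/h − 1⌋` cells used below). **It is now a theorem of the tree**:
   `Literature/NumberTheory/LFunctions/SelbergMollifier*.lean` formalise Titchmarsh §§10.9–10.22
   (Selberg's coefficients `α_ν`, `β_ν`, the mollifier `φ`, the kernel `F`, the measure-theoretic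
   skeleton of Theorem 10.22, and Lemmas 10.17, 10.18 and the dyadic content of Lemma 10.20 as
   the theorems `Titchmarsh1986_lemma_10_17_holds`, `Titchmarsh1986_lemma_10_18_holds`,
   `Titchmarsh1986_lemma_10_20_dyadic_holds`), whose assembly `selberg_volume_criticalZeros_ge`
   concludes literally with `hE`; hence `Radziwill2012_selbergLemma_holds` and the closed
   discharge `Radziwill2012_lemma5_holds` (both in `MollifierLimitationsHolds.lean`), and the term
   `Radziwill2012_lemma5_of_measure Radziwill2012_selbergLemma_holds` is a second closed proof
   of Lemma 5 (axioms `propext`, `Classical.choice`, `Quot.sound`).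
2. **The extraction** ("Hence at least `c·T/h` intervals `(T + nh; T + (n+1)h)` contain a `t` such
   that there is a zero with `β = ½` and `γ ∈ (t; t + h)`. It follows that at least `c·T/(2h)`
   intervals `(T + (n−1)h; T + (n+1)h)` contain the ordinate of a zero lying on the half-line.
   Taking every third such interval produces a sequence of `c·T/6h` intervals of length `2h`, and
   spaced by at least `h`, each containing the ordinate of a zero on the half-line."). This part is
   elementary and is **proved** here (`Radziwill2012_lemma5_of_measure`), with the constants
   `A` (the same `A`) and `c₀ = c/(12πA)`.

## The proof as formalised

With `h = 2πA/log T` and `M = ⌊T/h − 1⌋` we use the cells `C_n = [T + nh, T + (n+1)h)`, `n < M`,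
which cover `[T, T + Mh) ⊇ [T, 2T − 2h)`; the tail `[T + Mh, 2T]` has measure `< 2h`
(`Radziwill2012_lemma5.measure_le_card_cells`). If `G` is the set of `n < M` with `C_n ∩ E ≠ ∅`,
then `cT ≤ meas E ≤ Card G · h + 2h`. For `n ∈ G` pick `t_n ∈ C_n ∩ E` and a critical ordinate
`γ_n ∈ (t_n, t_n + h)`, so `T + nh < γ_n < T + (n+2)h ≤ 2T` (this is where `M` is one less than
the naive choice: the printed proof ignores that `γ` may exceed `2T` by `< h`; discarding the last
cells costs `O(1)` zeros). On a residue class `n ≡ r (mod 3)` the map `n ↦ γ_n` is strictly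
increasing with gaps `> h` (`Radziwill2012_lemma5.exists_separated_third`), and by pigeonhole some
class has `≥ Card G/3` elements. Hence `Card S ≥ (cT/h − 2)/3 = cT log T/(6πA) − 2/3 ≥
(c/(12πA)) T log T` once `T ≥ e` and `T ≥ 8πA/c`.

## References

* [Radziwill2012] M. Radziwiłł, *Limitations to mollifying ζ(s)*, arXiv:1207.6583 (2012), §4,
  Lemma 5 and its proof, p. 8.
* [Titchmarsh1986] E. C. Titchmarsh, *The Theory of the Riemann Zeta-Function*, 2nd ed. revised by
  D. R. Heath-Brown (1986), §10.22, Theorem 10.22 (`N₀(T) > AT log T`) and its proof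
  (`m(E) > A₃T` and the cell count), p. 279.
* [Selberg1942] A. Selberg, *On the zeros of Riemann's zeta-function*, Skr. Norske Vid.-Akad. Oslo
  I 1942, no. 10.
-/

noncomputable section

open Complex MeasureTheory Real

namespace Literature.Barriers.RiemannHypothesis

/-! ## Two elementary lemmas -/

/-- A point `t ≥ a` lies in the cell `[a + nh, a + (n+1)h)` with `n = ⌊(t − a)/h⌋`. [folklore] -/
theorem Radziwill2012_lemma5.mem_cell_floor {a h t : ℝ} (hh : 0 < h) (hat : a ≤ t) :
    t ∈ Set.Ico (a + ⌊(t - a) / h⌋₊ * h) (a + (⌊(t - a) / h⌋₊ + 1) * h) := by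
  have hx : 0 ≤ (t - a) / h := div_nonneg (by linarith) hh.le
  constructor
  · have h1 : (⌊(t - a) / h⌋₊ : ℝ) ≤ (t - a) / h := Nat.floor_le hx
    rw [le_div_iff₀ hh] at h1
    linarith
  · have h1 : (t - a) / h < ⌊(t - a) / h⌋₊ + 1 := Nat.lt_floor_add_one _
    rw [div_lt_iff₀ hh] at h1
    linarith

/-- **Counting cells that meet `E`.** If `E ⊆ [a, b]` and `G` contains every `n < M` whose cell
`[a + nh, a + (n+1)h)` meets `E`, then `meas E ≤ Card G · h + meas [a + Mh, b]`. [folklore] -/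
theorem Radziwill2012_lemma5.measure_le_card_cells {a b h : ℝ} (hh : 0 < h) (M : ℕ) {E : Set ℝ}
    (hE : E ⊆ Set.Icc a b) (G : Finset ℕ)
    (hG : ∀ n < M, ∀ t ∈ E, t ∈ Set.Ico (a + n * h) (a + (n + 1) * h) → n ∈ G) :
    volume E ≤ G.card * ENNReal.ofReal h + ENNReal.ofReal (b - (a + M * h)) := by
  have hsub : E ⊆ (⋃ n ∈ G, Set.Ico (a + n * h) (a + (n + 1) * h)) ∪ Set.Icc (a + M * h) b := by
    intro t ht
    have hab := hE ht
    by_cases htM : t < a + M * h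
    · left
      have hcell := Radziwill2012_lemma5.mem_cell_floor hh hab.1
      have hx : 0 ≤ (t - a) / h := div_nonneg (by linarith [hab.1]) hh.le
      have hnM : ⌊(t - a) / h⌋₊ < M := by
        rw [Nat.floor_lt hx, div_lt_iff₀ hh]
        linarith
      exact Set.mem_biUnion (hG _ hnM t ht hcell) hcell
    · right
      exact ⟨not_lt.1 htM, hab.2⟩
  have hcell_vol : ∀ n : ℕ, volume (Set.Ico (a + n * h) (a + (n + 1) * h)) = ENNReal.ofReal h := by
    intro n
    rw [Real.volume_Ico]
    congr 1
    ring
  calc volume E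
      ≤ volume ((⋃ n ∈ G, Set.Ico (a + n * h) (a + (n + 1) * h)) ∪ Set.Icc (a + M * h) b) :=
        measure_mono hsub
    _ ≤ volume (⋃ n ∈ G, Set.Ico (a + n * h) (a + (n + 1) * h)) + volume (Set.Icc (a + M * h) b) :=
        measure_union_le _ _
    _ ≤ (∑ n ∈ G, volume (Set.Ico (a + n * h) (a + (n + 1) * h))) +
          volume (Set.Icc (a + M * h) b) := by
        gcongr
        exact measure_biUnion_finset_le _ _
    _ = G.card * ENNReal.ofReal h + ENNReal.ofReal (b - (a + M * h)) := by
        simp only [hcell_vol, Finset.sum_const, nsmul_eq_mul, Real.volume_Icc]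

/-- **Every third window.** If `γ_n ∈ (a + nh, a + (n+2)h)` for `n ∈ G`, then on each residue
class mod `3` the map `n ↦ γ_n` has gaps `> h`, and some class carries at least a third of `G`:
there is `S ⊆ γ(G)` with `Card S ≥ Card G/3` and pairwise distances `≥ h`.
[cite: Radziwill2012, §4, proof of Lemma 5] -/
theorem Radziwill2012_lemma5.exists_separated_third {a h : ℝ} (hh : 0 < h) (G : Finset ℕ)
    (γ : ℕ → ℝ) (hγ : ∀ n ∈ G, a + n * h < γ n ∧ γ n < a + (n + 2) * h) :
    ∃ S : Finset ℝ, S ⊆ G.image γ ∧ (G.card : ℝ) / 3 ≤ S.card ∧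
      ∀ x ∈ S, ∀ y ∈ S, x ≠ y → h ≤ |x - y| := by
  classical
  -- pigeonhole on residues mod 3
  obtain ⟨r, -, hr⟩ : ∃ r ∈ Finset.range 3,
      (G.card : ℝ) / 3 ≤ ((G.filter fun n ↦ n % 3 = r).card : ℝ) := by
    apply Finset.exists_le_card_fiber_of_nsmul_le_card_of_maps_to
    · intro n _
      exact Finset.mem_range.2 (Nat.mod_lt n (by norm_num))
    · exact ⟨0, by simp⟩
    · rw [Finset.card_range, nsmul_eq_mul]
      exact le_of_eq (by push_cast; ring)
  set G' := G.filter fun n ↦ n % 3 = r with hG'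
  have hsep : ∀ n ∈ G', ∀ m ∈ G', n < m → γ n + h < γ m := by
    intro n hn m hm hnm
    rw [hG', Finset.mem_filter] at hn hm
    have h3 : n + 3 ≤ m := by omega
    have h3' : (n : ℝ) + 3 ≤ m := by exact_mod_cast h3
    have hn2 := (hγ n hn.1).2
    have hm1 := (hγ m hm.1).1
    have hmul : ((n : ℝ) + 3) * h ≤ m * h := mul_le_mul_of_nonneg_right h3' hh.le
    nlinarith
  have hinj : Set.InjOn γ G' := by
    intro n hn m hm heq
    rcases lt_trichotomy n m with hlt | heq' | hgt
    · have := hsep n hn m hm hlt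
      linarith
    · exact heq'
    · have := hsep m hm n hn hgt
      linarith
  refine ⟨G'.image γ, Finset.image_subset_image (Finset.filter_subset _ _), ?_, ?_⟩
  · rw [Finset.card_image_of_injOn hinj]
    exact hr
  · intro x hx y hy hxy
    obtain ⟨n, hn, rfl⟩ := Finset.mem_image.1 hx
    obtain ⟨m, hm, rfl⟩ := Finset.mem_image.1 hy
    rcases lt_trichotomy n m with hlt | heq' | hgt
    · have := hsep n hn m hm hlt
      rw [abs_sub_comm, abs_of_pos (by linarith)]
      linarith
    · exact absurd (congrArg γ heq') hxy
    · have := hsep m hm n hn hgt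
      rw [abs_of_pos (by linarith)]
      linarith

/-! ## Lemma 5 from Selberg's theorem in measure form -/

/-- **Radziwiłł 2012, Lemma 5, from Selberg's theorem in measure form** (the deduction printed on
p. 8). Hypothesis `hE` is the displayed input "there is an `h = 2πA/log T`, with `A > 0` constant,
for which `E = {T ≤ t ≤ 2T : γ ∈ (t; t+h) for some ρ = ½ + iγ}` has `meas{E} ≥ c·T`", read for
all large `T` (Selberg 1942; [Titchmarsh1986, §10.22, p. 279, `m(E) > A₃T`]); the conclusion is
`Radziwill2012_lemma5` with the same `A` and `c₀ = c/(12πA)`, valid for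
`T ≥ max T₀ (max e (8πA/c + 2πA))`. [cite: Radziwill2012, Lemma 5 (proof, §4, p. 8)] -/
theorem Radziwill2012_lemma5_of_measure
    (hE : ∃ A : ℝ, 0 < A ∧ ∃ c : ℝ, 0 < c ∧ ∃ T₀ : ℝ, ∀ T : ℝ, T₀ ≤ T →
      ENNReal.ofReal (c * T) ≤ volume {t : ℝ | t ∈ Set.Icc T (2 * T) ∧
        ∃ γ ∈ Set.Ioo t (t + 2 * π * A / Real.log T), riemannZeta (1 / 2 + γ * I) = 0}) :
    Radziwill2012_lemma5 := by
  classical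
  obtain ⟨A, hA, c, hc, T₀, hET⟩ := hE
  refine ⟨A, hA, c / (12 * π * A), by positivity, max T₀ (max (Real.exp 1) (8 * π * A / c + 2 * π * A)),
    fun T hT ↦ ?_⟩
  -- unpacking `T large`
  have hT0 : T₀ ≤ T := le_trans (le_max_left _ _) hT
  have hTe : Real.exp 1 ≤ T := le_trans (le_trans (le_max_left _ _) (le_max_right _ _)) hT
  have hT8 : 8 * π * A / c + 2 * π * A ≤ T :=
    le_trans (le_trans (le_max_right _ _) (le_max_right _ _)) hT
  have hTpos : 0 < T := lt_of_lt_of_le (Real.exp_pos 1) hTe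
  have hlog1 : 1 ≤ Real.log T := by
    rw [Real.le_log_iff_exp_le hTpos]
    exact hTe
  have hlog : 0 < Real.log T := by linarith
  -- the spacing `h = 2πA / log T`
  set h : ℝ := 2 * π * A / Real.log T with hh_def
  have hh : 0 < h := by positivity
  have h2πA : 0 < 2 * π * A := by positivity
  have hhle : h ≤ 2 * π * A := by
    rw [hh_def, div_le_iff₀ hlog]
    calc 2 * π * A = 2 * π * A * 1 := by ring
      _ ≤ 2 * π * A * Real.log T := mul_le_mul_of_nonneg_left hlog1 h2πA.le
  have h8 : 8 * π * A / c ≤ T := by nlinarith [Real.pi_pos]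
  have hTh : h ≤ T := by
    have : 0 ≤ 8 * π * A / c := by positivity
    linarith
  -- the set `E` and its measure
  set E : Set ℝ := {t : ℝ | t ∈ Set.Icc T (2 * T) ∧
    ∃ γ ∈ Set.Ioo t (t + 2 * π * A / Real.log T), riemannZeta (1 / 2 + γ * I) = 0} with hE_def
  have hmeas : ENNReal.ofReal (c * T) ≤ volume E := hET T hT0
  have hEsub : E ⊆ Set.Icc T (2 * T) := fun t ht ↦ ht.1
  -- the number of cells: `(M + 1) h ≤ T < (M + 2) h`
  set M : ℕ := ⌊T / h - 1⌋₊ with hM_def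
  have hx0 : 0 ≤ T / h - 1 := by
    rw [sub_nonneg, le_div_iff₀ hh, one_mul]
    exact hTh
  have hM1 : ((M : ℝ) + 1) * h ≤ T := by
    have h1 : (M : ℝ) ≤ T / h - 1 := Nat.floor_le hx0
    have h2 : (M : ℝ) + 1 ≤ T / h := by linarith
    rwa [le_div_iff₀ hh] at h2
  have hM2 : T - M * h < 2 * h := by
    have h1 : T / h - 1 < M + 1 := Nat.lt_floor_add_one _
    have h2 : T / h < M + 2 := by linarith
    rw [div_lt_iff₀ hh] at h2
    linarith
  -- the good cells
  set G : Finset ℕ := (Finset.range M).filter fun n ↦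
    ∃ t ∈ E, t ∈ Set.Ico (T + n * h) (T + (n + 1) * h) with hG_def
  have hGmem : ∀ n < M, ∀ t ∈ E, t ∈ Set.Ico (T + n * h) (T + (n + 1) * h) → n ∈ G := by
    intro n hn t ht hcell
    rw [hG_def, Finset.mem_filter, Finset.mem_range]
    exact ⟨hn, t, ht, hcell⟩
  -- `c T ≤ Card G · h + (T - M h) < Card G · h + 2 h`
  have hcount : c * T ≤ G.card * h + (T - M * h) := by
    have h1 := Radziwill2012_lemma5.measure_le_card_cells hh M hEsub G hGmem
    have h2 : volume E ≤ ENNReal.ofReal (G.card * h + (T - M * h)) := by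
      refine le_trans h1 (le_of_eq ?_)
      have hGh : 0 ≤ (G.card : ℝ) * h := by positivity
      have hTM : 0 ≤ T - M * h := by nlinarith
      have hTM' : 2 * T - (T + M * h) = T - M * h := by ring
      rw [hTM', ENNReal.ofReal_add hGh hTM, ENNReal.ofReal_mul (by positivity),
        ENNReal.ofReal_natCast]
    have h3 := le_trans hmeas h2
    rwa [ENNReal.ofReal_le_ofReal_iff (by nlinarith)] at h3
  -- choosing a critical ordinate above each good cell
  have hchoice : ∀ n ∈ G, ∃ γ : ℝ, (T + n * h < γ ∧ γ < T + (n + 2) * h) ∧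
      riemannZeta (1 / 2 + γ * I) = 0 := by
    intro n hn
    rw [hG_def, Finset.mem_filter] at hn
    obtain ⟨-, t, ht, hcell⟩ := hn
    obtain ⟨-, γ, hγ, hzero⟩ := ht
    refine ⟨γ, ⟨?_, ?_⟩, hzero⟩
    · exact lt_of_le_of_lt hcell.1 hγ.1
    · have := hγ.2
      have := hcell.2
      rw [← hh_def] at *
      linarith
  choose! γ hγ hzero using hchoice
  obtain ⟨S, hSsub, hScard, hSsep⟩ :=
    Radziwill2012_lemma5.exists_separated_third hh G γ hγ
  refine ⟨S, ?_, ?_, ?_⟩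
  · -- members of `S` are critical ordinates in `[T, 2T]`
    intro x hx
    obtain ⟨n, hn, rfl⟩ := Finset.mem_image.1 (hSsub hx)
    have hnM : n < M := by
      have := Finset.mem_filter.1 (by rw [hG_def] at hn; exact hn)
      exact Finset.mem_range.1 this.1
    have hnM' : (n : ℝ) + 2 ≤ M + 1 := by
      have : n + 2 ≤ M + 1 := by omega
      exact_mod_cast this
    refine ⟨⟨?_, ?_⟩, hzero n hn⟩
    · have := (hγ n hn).1
      have : (0 : ℝ) ≤ n * h := by positivity
      linarith
    · have h1 := (hγ n hn).2
      have h2 : ((n : ℝ) + 2) * h ≤ (M + 1) * h := mul_le_mul_of_nonneg_right hnM' hh.le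
      linarith
  · -- spacing
    intro x hx y hy hxy
    exact hSsep x hx y hy hxy
  · -- cardinality: `c/(12πA) · T log T ≤ Card S`
    have hGcard : c * T / h - 2 ≤ (G.card : ℝ) := by
      rw [sub_le_iff_le_add, div_le_iff₀ hh]
      nlinarith
    have hkey : c * T / h = c * T * Real.log T / (2 * π * A) := by
      rw [hh_def]
      field_simp
    have hS3 : c * T * Real.log T / (6 * π * A) - 2 / 3 ≤ (S.card : ℝ) := by
      have : (c * T / h - 2) / 3 ≤ (S.card : ℝ) := by
        have := div_le_div_of_nonneg_right hGcard (by norm_num : (0 : ℝ) ≤ 3)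
        linarith
      rw [hkey] at this
      have hrw : (c * T * Real.log T / (2 * π * A) - 2) / 3 =
          c * T * Real.log T / (6 * π * A) - 2 / 3 := by
        field_simp
        ring
      linarith
    -- `c T log T/(12πA) ≥ 2/3` since `T log T ≥ T ≥ 8πA/c`
    have hbig : 2 / 3 ≤ c * T * Real.log T / (12 * π * A) := by
      rw [le_div_iff₀ (by positivity)]
      have h1 : c * T ≤ c * T * Real.log T := by
        have := mul_le_mul_of_nonneg_left hlog1 (by positivity : (0 : ℝ) ≤ c * T)
        linarith
      have h2 : 8 * π * A ≤ c * T := by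
        have := mul_le_mul_of_nonneg_left h8 hc.le
        rw [mul_div_cancel₀ _ hc.ne'] at this
        linarith
      nlinarith [Real.pi_pos]
    have hrw : c / (12 * π * A) * T * Real.log T = c * T * Real.log T / (12 * π * A) := by ring
    have hrw2 : c * T * Real.log T / (6 * π * A) = 2 * (c * T * Real.log T / (12 * π * A)) := by
      field_simp
      ring
    rw [hrw]
    linarith

end Literature.Barriers.RiemannHypothesis
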